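import Summits.QuantumFields.BalabanUV.Beta.GAN24.Push4Bounds

/-!
# `BalabanUV.Beta.GAN24.Push4LocStencil` — binder row G-an2-4 / (CONV-C), W-slot road «W3» (SKELETON-W3 v0.2 §7.3 (T-marg) shape, one push):
# THE FOUR-LEG PUSH IS A `LocStencil₂` FAMILY AT THE DILATED RATE — `LocStencil₂ X C δ ⟹ LocStencil₂ (push₄ l r X) (cPush·C) (N·δ)` for leg
# families at rate `m > 3δ` (part 2 of 2 of the rate-kept bounds; companion of `GAN24/Push4` p210922 and `GAN24/Push4Bounds`)

NOT IN PRINT; OUR PROOF ATTEMPT (G-an2-4 formalisation swarm, leaf prover `b2b-balaban-gan24-formalise-leaf-17`, gen 14; names PROVISIONAL — the row owner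
gan24-p1 may rename / re-cut).  HONEST FRAMING (cell contract, verbatim): «discharging `BetaPertH` makes Bałaban's UV stability UNCONDITIONAL — a real
constructive-QFT result; it is NOT the continuum limit and NOT the Clay problem.»  HONEST DEPENDENCY (verbatim): «continuum YM on T⁴ ⇐ BetaPertH ∧ nine
spine estimates (0/9 proved); BetaPertH ⇐ (D1) ∧ (D4) ∧ CAP+tail; G-an2-4 gates asym, D1 and NE2/3/4.»

CONTENT ([folklore]; the triangle inequality budgeted with two rates, as in part 1).
* `abs_ffRead_le`; `abs_comp_Lk_le` — the LEFT kernel leg `Lk l` (legs at rate `m` from the dilated coarse row index) against a kernel bi-localised at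
  `(N•y, N•y)` at rate `δ < m`: the first (now COARSE) index is localised at `y` at the DILATED distance `|N•x′ − N•y|₁`, the second leg untouched, constant
  `(d+1)·C_l·K₀·Zl(m−δ)`; `abs_comp_Rk_le` — the RIGHT kernel leg likewise.
* `cPush d C_l C_r m δ := (d+1)⁴·C_l·C_r³·Zl(m−δ)³·Zl(m−3δ)` (+ `cPush_nonneg`) and **`locStencil₂_push₄`**:
  `LegDecay l N C_l m → LegDecay r N C_r m → LocStencil₂ X C δ → 0 ≤ δ → 3δ < m → LocStencil₂ (push₄ l r X) (cPush d C_l C_r m δ · C) ((N:ℝ)·δ)` —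
  the table's rate is KEPT through all four legs and DILATED by the coarse re-indexing (`l1 (N•z) = N·l1 z`); ONE constant for every member, LINEAR in `C`,
  free of every level index (RULINGS-12 (R12-2)); `locStencil₂_push₄_mono` (rate `δ`, `N ≥ 1`).  This is the one-push (T-marg) SHAPE; for the composite
  push `𝒫_{n←m}` the legs are `legComp`-chains (`Push4Nest`) whose `LegDecay` data are road P1's decimated-column bounds («W3-LEGS*»), and |ĉ| ≤ 1 is the
  END's (hpin).
Asserts NO shape of Bałaban's tables; «T2Shape» / «T2SupRate» LOCATED / OPEN, NOT IN PRINT; discharges NOTHING of (hW, hWall); 0 wall binders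
instantiated; NOT «W-slot closed», NEVER «G-an2-4 closed»; NOT BetaPertH, NOT continuum, NOT Clay.  0 cited facts, 0 `Prop` mirrors, 0 sorry.
-/

noncomputable section

open Finset
open scoped BigOperators
open Literature.MathematicalPhysics.QuantumFieldTheory
open Literature.MathematicalPhysics.QuantumFieldTheory.Balaban1983to89
open Literature.MathematicalPhysics.QuantumFieldTheory.Balaban1983to89.Beta
open B12Sec2to5 (l1 l1_nonneg)
open ExpKernelCalculus (MKer Decays BiLoc comp Zl Zl_nonneg l1_sub_triangle l1_sub_symm l1_natSmul summable_exp_shift summable_exp_shift'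
  tsum_exp_shift tsum_exp_shift')
open OneStepResolventKernel (Fib wsum LocStencil biLoc_finset_sum biLoc_mono)
open OneStepKernelFamily (colH)
open BalabanCompositeJets (LocStencil₂)
open Summit.QuantumFields.BalabanUV.Beta.GAN24.Push4 (rowM rowM_apply colH_apply' vertexW vertexW_apply vertex2W Lk Rk ffRead push₄
  Lk_inl_inl Lk_inl_inr Lk_inr Rk_inl_inl Rk_inr_left Rk_inr_right ffRead_inl_inl ffRead_inr_left ffRead_inr_right push₄_def)
open Summit.QuantumFields.BalabanUV.Beta.GAN24.Push4Bounds (LegDecay LegDecay.nonneg biLoc_vertex2W_keep)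

namespace Summit.QuantumFields.BalabanUV.Beta.GAN24.Push4LocStencil

variable {d : ℕ}
variable {r l : Fin (d + 1) → (Fin (d + 1) → ℤ) → Fin (d + 1) → (Fin (d + 1) → ℤ) → ℝ} {N : ℕ} {C Cr Cl m δ : ℝ}

/-! ## The kernel legs at kept rate and the `LocStencil₂` bound of the push -/

/-- [folklore] `ffRead` only zeroes entries: `|ffRead P x z a b| ≤ |P x z a b|`. -/
theorem abs_ffRead_le (P : MKer (d + 1) (Fib d)) (x z : Fin (d + 1) → ℤ) (a b : Fib d) : |ffRead P x z a b| ≤ |P x z a b| := by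
  rcases a with α | μ
  · rcases b with β | ν
    · rw [ffRead_inl_inl]
    · rw [ffRead_inr_right, abs_zero]; exact abs_nonneg _
  · rw [ffRead_inr_left, abs_zero]; exact abs_nonneg _

/-- [folklore] **LEFT LEG KERNEL AT KEPT RATE**: `Lk l` (legs at rate `m` from the dilated coarse row index) composed with a kernel bi-localised at
`(N•y, N•y)` at rate `δ < m` ⟹ the first (now COARSE) index is localised at `y` at the DILATED distance `|N•x′ − N•y|₁`, the second leg is untouched:
`|comp (Lk l) W x′ z a b| ≤ (d+1)·C_l·K₀·Zl(m−δ)·e^{−δ(|N•x′ − N•y|₁ + |z − N•y|₁)}`. -/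
theorem abs_comp_Lk_le (hl : LegDecay l N Cl m) {W : MKer (d + 1) (Fib d)} {K₀ : ℝ} {y : Fin (d + 1) → ℤ}
    (hW : BiLoc W ((N : ℤ) • y) ((N : ℤ) • y) K₀ δ) (hδ : 0 ≤ δ) (hm : δ < m) (x' z : Fin (d + 1) → ℤ) (a b : Fib d) :
    |comp (Lk l) W x' z a b| ≤
      (d + 1 : ℕ) * (Cl * K₀ * Zl (d + 1) (m - δ)) * Real.exp (-δ * (l1 ((N : ℤ) • x' - (N : ℤ) • y) + l1 (z - (N : ℤ) • y))) := by
  have hCl := hl.nonneg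
  have hK₀ : 0 ≤ K₀ := hW.nonneg (Sum.inl 0)
  have hZ : 0 ≤ Zl (d + 1) (m - δ) := Zl_nonneg (by linarith)
  rcases a with α | μ'
  · -- termwise bound
    have hpt : ∀ x : Fin (d + 1) → ℤ, |∑ f : Fib d, Lk l x' x (Sum.inl α) f * W x z f b|
        ≤ (d + 1 : ℕ) * (Cl * K₀) * Real.exp (-δ * (l1 ((N : ℤ) • x' - (N : ℤ) • y) + l1 (z - (N : ℤ) • y))) *
            Real.exp (-(m - δ) * l1 (x - (N : ℤ) • x')) := by
      intro x
      have hexp : Real.exp (-m * l1 (x - (N : ℤ) • x')) * Real.exp (-δ * (l1 (x - (N : ℤ) • y) + l1 (z - (N : ℤ) • y)))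
          ≤ Real.exp (-δ * (l1 ((N : ℤ) • x' - (N : ℤ) • y) + l1 (z - (N : ℤ) • y))) * Real.exp (-(m - δ) * l1 (x - (N : ℤ) • x')) := by
        rw [← Real.exp_add, ← Real.exp_add, Real.exp_le_exp]
        have t := l1_sub_triangle ((N : ℤ) • x') x ((N : ℤ) • y)
        rw [l1_sub_symm ((N : ℤ) • x') x] at t
        nlinarith [mul_nonneg hδ (show 0 ≤ l1 (x - (N : ℤ) • x') + l1 (x - (N : ℤ) • y) - l1 ((N : ℤ) • x' - (N : ℤ) • y) by linarith)]
      have hterm : ∀ κ : Fin (d + 1), |Lk l x' x (Sum.inl α) (Sum.inl κ) * W x z (Sum.inl κ) b|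
          ≤ Cl * K₀ * (Real.exp (-m * l1 (x - (N : ℤ) • x')) * Real.exp (-δ * (l1 (x - (N : ℤ) • y) + l1 (z - (N : ℤ) • y)))) := by
        intro κ
        rw [abs_mul, Lk_inl_inl]
        calc |l α x' κ x| * |W x z (Sum.inl κ) b|
            ≤ (Cl * Real.exp (-m * l1 (x - (N : ℤ) • x'))) * (K₀ * Real.exp (-δ * (l1 (x - (N : ℤ) • y) + l1 (z - (N : ℤ) • y)))) :=
              mul_le_mul (hl α x' κ x) (hW x z _ b) (abs_nonneg _) (by positivity)
          _ = _ := by ring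
      rw [Fintype.sum_sum_type]
      simp only [Lk_inl_inr, zero_mul, Finset.sum_const_zero, add_zero]
      calc |∑ κ : Fin (d + 1), Lk l x' x (Sum.inl α) (Sum.inl κ) * W x z (Sum.inl κ) b|
          ≤ ∑ κ : Fin (d + 1), |Lk l x' x (Sum.inl α) (Sum.inl κ) * W x z (Sum.inl κ) b| := Finset.abs_sum_le_sum_abs _ _
        _ ≤ ∑ _κ : Fin (d + 1), Cl * K₀ * (Real.exp (-m * l1 (x - (N : ℤ) • x')) *
              Real.exp (-δ * (l1 (x - (N : ℤ) • y) + l1 (z - (N : ℤ) • y)))) := Finset.sum_le_sum fun κ _ => hterm κ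
        _ = (d + 1 : ℕ) * (Cl * K₀ * (Real.exp (-m * l1 (x - (N : ℤ) • x')) *
              Real.exp (-δ * (l1 (x - (N : ℤ) • y) + l1 (z - (N : ℤ) • y))))) := by
            rw [Finset.sum_const, Finset.card_univ, Fintype.card_fin, nsmul_eq_mul]
        _ ≤ (d + 1 : ℕ) * (Cl * K₀ * (Real.exp (-δ * (l1 ((N : ℤ) • x' - (N : ℤ) • y) + l1 (z - (N : ℤ) • y))) *
              Real.exp (-(m - δ) * l1 (x - (N : ℤ) • x')))) :=
            mul_le_mul_of_nonneg_left (mul_le_mul_of_nonneg_left hexp (mul_nonneg hCl hK₀)) (Nat.cast_nonneg _)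
        _ = _ := by ring
    unfold comp
    have hs := (summable_exp_shift' (show 0 < m - δ by linarith) ((N : ℤ) • x')).mul_left
      ((d + 1 : ℕ) * (Cl * K₀) * Real.exp (-δ * (l1 ((N : ℤ) • x' - (N : ℤ) • y) + l1 (z - (N : ℤ) • y))))
    have hb := tsum_of_norm_bounded hs.hasSum (fun x => by rw [Real.norm_eq_abs]; exact hpt x)
    rw [Real.norm_eq_abs] at hb
    refine hb.trans (le_of_eq ?_)
    rw [tsum_mul_left, tsum_exp_shift']
    ring
  · unfold comp
    simp only [Lk_inr, zero_mul, Finset.sum_const_zero, tsum_zero, abs_zero]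
    positivity

/-- [folklore] **RIGHT LEG KERNEL AT KEPT RATE**: a kernel whose entries are bounded by `K₁·e^{−δ(|N•x′ − N•y|₁ + |z − N•y|₁)}` composed on the right with
`Rk r` (legs at rate `m > δ`) has both indices on the COARSE lattice, localised at `y` at the dilated distances:
`|comp M (Rk r) x′ z′ a b| ≤ (d+1)·K₁·C_r·Zl(m−δ)·e^{−δ(|N•x′ − N•y|₁ + |N•z′ − N•y|₁)}`. -/
theorem abs_comp_Rk_le (hr : LegDecay r N Cr m) {M : MKer (d + 1) (Fib d)} {K₁ : ℝ} {y : Fin (d + 1) → ℤ} (hK₁ : 0 ≤ K₁)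
    (hM : ∀ x' z a g, |M x' z a g| ≤ K₁ * Real.exp (-δ * (l1 ((N : ℤ) • x' - (N : ℤ) • y) + l1 (z - (N : ℤ) • y))))
    (hδ : 0 ≤ δ) (hm : δ < m) (x' z' : Fin (d + 1) → ℤ) (a b : Fib d) :
    |comp M (Rk r) x' z' a b| ≤
      (d + 1 : ℕ) * (K₁ * Cr * Zl (d + 1) (m - δ)) *
        Real.exp (-δ * (l1 ((N : ℤ) • x' - (N : ℤ) • y) + l1 ((N : ℤ) • z' - (N : ℤ) • y))) := by
  have hCr := hr.nonneg
  have hZ : 0 ≤ Zl (d + 1) (m - δ) := Zl_nonneg (by linarith)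
  rcases b with β | ν
  · have hpt : ∀ z : Fin (d + 1) → ℤ, |∑ g : Fib d, M x' z a g * Rk r z z' g (Sum.inl β)|
        ≤ (d + 1 : ℕ) * (K₁ * Cr) * Real.exp (-δ * (l1 ((N : ℤ) • x' - (N : ℤ) • y) + l1 ((N : ℤ) • z' - (N : ℤ) • y))) *
            Real.exp (-(m - δ) * l1 (z - (N : ℤ) • z')) := by
      intro z
      have hexp : Real.exp (-δ * (l1 ((N : ℤ) • x' - (N : ℤ) • y) + l1 (z - (N : ℤ) • y))) * Real.exp (-m * l1 (z - (N : ℤ) • z'))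
          ≤ Real.exp (-δ * (l1 ((N : ℤ) • x' - (N : ℤ) • y) + l1 ((N : ℤ) • z' - (N : ℤ) • y))) *
              Real.exp (-(m - δ) * l1 (z - (N : ℤ) • z')) := by
        rw [← Real.exp_add, ← Real.exp_add, Real.exp_le_exp]
        have t := l1_sub_triangle ((N : ℤ) • z') z ((N : ℤ) • y)
        rw [l1_sub_symm ((N : ℤ) • z') z] at t
        nlinarith [mul_nonneg hδ (show 0 ≤ l1 (z - (N : ℤ) • z') + l1 (z - (N : ℤ) • y) - l1 ((N : ℤ) • z' - (N : ℤ) • y) by linarith)]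
      have hterm : ∀ κ : Fin (d + 1), |M x' z a (Sum.inl κ) * Rk r z z' (Sum.inl κ) (Sum.inl β)|
          ≤ K₁ * Cr * (Real.exp (-δ * (l1 ((N : ℤ) • x' - (N : ℤ) • y) + l1 (z - (N : ℤ) • y))) * Real.exp (-m * l1 (z - (N : ℤ) • z'))) := by
        intro κ
        rw [abs_mul, Rk_inl_inl]
        calc |M x' z a (Sum.inl κ)| * |r β z' κ z|
            ≤ (K₁ * Real.exp (-δ * (l1 ((N : ℤ) • x' - (N : ℤ) • y) + l1 (z - (N : ℤ) • y)))) * (Cr * Real.exp (-m * l1 (z - (N : ℤ) • z'))) :=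
              mul_le_mul (hM x' z a (Sum.inl κ)) (hr β z' κ z) (abs_nonneg _) (by positivity)
          _ = _ := by ring
      rw [Fintype.sum_sum_type]
      simp only [Rk_inr_left, mul_zero, Finset.sum_const_zero, add_zero]
      calc |∑ κ : Fin (d + 1), M x' z a (Sum.inl κ) * Rk r z z' (Sum.inl κ) (Sum.inl β)|
          ≤ ∑ κ : Fin (d + 1), |M x' z a (Sum.inl κ) * Rk r z z' (Sum.inl κ) (Sum.inl β)| := Finset.abs_sum_le_sum_abs _ _
        _ ≤ ∑ _κ : Fin (d + 1), K₁ * Cr * (Real.exp (-δ * (l1 ((N : ℤ) • x' - (N : ℤ) • y) + l1 (z - (N : ℤ) • y))) *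
              Real.exp (-m * l1 (z - (N : ℤ) • z'))) := Finset.sum_le_sum fun κ _ => hterm κ
        _ = (d + 1 : ℕ) * (K₁ * Cr * (Real.exp (-δ * (l1 ((N : ℤ) • x' - (N : ℤ) • y) + l1 (z - (N : ℤ) • y))) *
              Real.exp (-m * l1 (z - (N : ℤ) • z')))) := by
            rw [Finset.sum_const, Finset.card_univ, Fintype.card_fin, nsmul_eq_mul]
        _ ≤ (d + 1 : ℕ) * (K₁ * Cr * (Real.exp (-δ * (l1 ((N : ℤ) • x' - (N : ℤ) • y) + l1 ((N : ℤ) • z' - (N : ℤ) • y))) *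
              Real.exp (-(m - δ) * l1 (z - (N : ℤ) • z')))) :=
            mul_le_mul_of_nonneg_left (mul_le_mul_of_nonneg_left hexp (mul_nonneg hK₁ hCr)) (Nat.cast_nonneg _)
        _ = _ := by ring
    unfold comp
    have hs := (summable_exp_shift' (show 0 < m - δ by linarith) ((N : ℤ) • z')).mul_left
      ((d + 1 : ℕ) * (K₁ * Cr) * Real.exp (-δ * (l1 ((N : ℤ) • x' - (N : ℤ) • y) + l1 ((N : ℤ) • z' - (N : ℤ) • y))))
    have hb := tsum_of_norm_bounded hs.hasSum (fun z => by rw [Real.norm_eq_abs]; exact hpt z)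
    rw [Real.norm_eq_abs] at hb
    refine hb.trans (le_of_eq ?_)
    rw [tsum_mul_left, tsum_exp_shift']
    ring
  · unfold comp
    simp only [Rk_inr_right, mul_zero, Finset.sum_const_zero, tsum_zero, abs_zero]
    positivity

/-- [folklore] THE CONSTANT of `locStencil₂_push₄`: `(d+1)⁴·C_l·C_r³·Zl(m−δ)³·Zl(m−3δ)` (explicit; free of every level index; the bound is LINEAR in
the table's constant `C`). -/
def cPush (d : ℕ) (Cl Cr m δ : ℝ) : ℝ :=
  ((d + 1 : ℕ) : ℝ) ^ 4 * Cl * Cr ^ 3 * Zl (d + 1) (m - δ) ^ 3 * Zl (d + 1) (m - 3 * δ)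

/-- [folklore] `cPush` is nonnegative for nonnegative leg constants and `m > 3δ ≥ 0`. -/
theorem cPush_nonneg (hCl : 0 ≤ Cl) (hCr : 0 ≤ Cr) (hδ : 0 ≤ δ) (hm : 3 * δ < m) : 0 ≤ cPush d Cl Cr m δ := by
  unfold cPush
  have := Zl_nonneg (D := d + 1) (show 0 < m - δ by linarith)
  have := Zl_nonneg (D := d + 1) (show 0 < m - 3 * δ by linarith)
  positivity

/-- [folklore] **THE FOUR-LEG PUSH IS A `LocStencil₂` FAMILY AT THE DILATED RATE.**  Leg families `l`, `r` localised at rate `m` from the `N`-dilated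
coarse point, a bi-stencil table `X` in `LocStencil₂` at rate `δ` with `0 ≤ δ` and `3δ < m` ⟹
`LocStencil₂ (push₄ l r X) (cPush d C_l C_r m δ · C) (N·δ)` — the table's rate is KEPT through the two table legs and the two kernel legs (§2–§4) and
DILATED by the re-indexing to the coarse lattice (`l1 (N•z) = N·l1 z`); ONE constant for every member, linear in `C`.  The one-step (T-marg)-type
statement of SKELETON-W3 §7.3 for a single push; for the composite push the legs are `legComp`-chains (`Push4Nest`) and their `LegDecay` data are road
P1's (N1)/(N1′) bounds («W3-LEGS*»). -/
theorem locStencil₂_push₄ (hl : LegDecay l N Cl m) (hr : LegDecay r N Cr m)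
    {X : Fin (d + 1) → (Fin (d + 1) → ℤ) → Fin (d + 1) → (Fin (d + 1) → ℤ) → MKer (d + 1) (Fib d)} (hX : LocStencil₂ X C δ)
    (hδ : 0 ≤ δ) (hm : 3 * δ < m) : LocStencil₂ (push₄ l r X) (cPush d Cl Cr m δ * C) ((N : ℝ) * δ) := by
  intro μ y ν y' x' z' a b
  have hC := hX.nonneg
  have hCl := hl.nonneg
  have hCr := hr.nonneg
  have hZ1 : 0 ≤ Zl (d + 1) (m - δ) := Zl_nonneg (by linarith)
  have hZ3 : 0 ≤ Zl (d + 1) (m - 3 * δ) := Zl_nonneg (by linarith)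
  -- the table legs (§3)
  have hW := biLoc_vertex2W_keep hr hX hδ hm μ y ν y'
  -- the left kernel leg
  have hM := abs_comp_Lk_le hl hW hδ (by linarith)
  -- the right kernel leg
  have hK₁ : 0 ≤ (d + 1 : ℕ) * (Cl * ((d + 1 : ℕ) * (Cr * ((d + 1 : ℕ) * (Cr * C * Zl (d + 1) (m - δ))) * Zl (d + 1) (m - 3 * δ)
      * Real.exp (-δ * l1 ((N : ℤ) • y - (N : ℤ) • y')))) * Zl (d + 1) (m - δ)) := by positivity
  have hP := abs_comp_Rk_le hr hK₁ hM hδ (by linarith) x' z' a b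
  rw [push₄_def]
  refine (abs_ffRead_le _ x' z' a b).trans (hP.trans (le_of_eq ?_))
  -- dilation bookkeeping: every distance on the coarse lattice is an `N`-dilated fine distance
  have e1 : l1 ((N : ℤ) • y - (N : ℤ) • y') = (N : ℝ) * l1 (y' - y) := by rw [← smul_sub, l1_natSmul, l1_sub_symm]
  have e2 : l1 ((N : ℤ) • x' - (N : ℤ) • y) = (N : ℝ) * l1 (x' - y) := by rw [← smul_sub, l1_natSmul]
  have e3 : l1 ((N : ℤ) • z' - (N : ℤ) • y) = (N : ℝ) * l1 (z' - y) := by rw [← smul_sub, l1_natSmul]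
  rw [e1, e2, e3]
  have hE1 : Real.exp (-δ * ((N : ℝ) * l1 (y' - y))) = Real.exp (-((N : ℝ) * δ) * l1 (y' - y)) := by congr 1; ring
  have hE2 : Real.exp (-δ * ((N : ℝ) * l1 (x' - y) + (N : ℝ) * l1 (z' - y)))
      = Real.exp (-((N : ℝ) * δ) * (l1 (x' - y) + l1 (z' - y))) := by congr 1; ring
  rw [hE1, hE2, cPush]
  ring

/-- [folklore] The same at the UNDILATED rate `δ` (`N ≥ 1`; `LocStencil₂.mono`). -/
theorem locStencil₂_push₄_mono (hN : 1 ≤ N) (hl : LegDecay l N Cl m) (hr : LegDecay r N Cr m)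
    {X : Fin (d + 1) → (Fin (d + 1) → ℤ) → Fin (d + 1) → (Fin (d + 1) → ℤ) → MKer (d + 1) (Fib d)} (hX : LocStencil₂ X C δ)
    (hδ : 0 ≤ δ) (hm : 3 * δ < m) : LocStencil₂ (push₄ l r X) (cPush d Cl Cr m δ * C) δ := by
  refine (locStencil₂_push₄ hl hr hX hδ hm).mono ?_
  have h1 : (1 : ℝ) ≤ N := by exact_mod_cast hN
  nlinarith

end Summit.QuantumFields.BalabanUV.Beta.GAN24.Push4LocStencil

end
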